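import Summits.BirchSwinnertonDyer.BirchSwinnertonDyer.Theorems.AdditiveBranchIMCGordTwoRankOneHeegnerKolyvaginItem
import HarnessLib

/-!
# Route `AdditiveBranchIMC` (rung K1), crux `GordTwoRankOne` (item 19358): the Heegner–Kolyvagin road,
# Part 15 — ALL ROWS, IMAGE-FREE: the crux on every non-CM rank-one row of cell (G-ord, `e = 2`) is
# EQUIVALENT, modulo PUBLISHED facts and the rank-zero twists' `p`-parts, to STEP L′ at the Heegner data
# (lane `bsd-addord-k1-c3x`, gen 2; `--supports` only)

HONEST FRAMING. THEOREMS ONLY: no definition, no new named fact, no `sorry`; nothing is booked; the crux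
stays OPEN; «BSD is not proved by any of this». Parts 8/12/14 split the rows of 19358 by the image of
`ρ̄_{E,p}` only because the rank-ZERO twist's upper bound is supplied by different inputs there (Kato 2004
Thm 14.5 (3) on tower-surjective image; Kato + Coates–Sujatha (A) on small irreducible image; nothing in
print on reducible image at an additive prime). The Heegner–Kolyvagin side itself never looks at the image.
THIS FILE records that uniformly:

* §31 `missingLowerBoundAt_rankOne_additive_of_adjustedIndexBound_of_twistUpper` — POINTWISE, ANY image:
  PUB (`hGZ`, `hKo`, `hGZK`, `hmod`) + STEP L′ at a Heegner datum + the rank-zero UPPER half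
  `Typed.MissingUpperBoundAt Wd p` of the twist (Miller's currency) ⟹ `Typed.MissingLowerBoundAt W p`.
* §32 `cellGordTwo_missingLowerBoundAt_rankOne_allRows_of_adjustedIndexBound_of_twistUpper` — CLASS LEVEL
  on ALL rank-one rows of the cell (CM or not, any image): PUB (+ `hnf`, `hmodP`, `hFH`) + `hLall` (STEP L′
  at the Heegner data of every rank-one row — item 20498's body WITHOUT its image binder) + `hUall`
  (`Typed.MissingUpperBoundAt Wd p` at the Friedberg–Hoffstein twists) ⟹ the crux's conclusion everywhere;
  and `gordTwoRankOne_of_adjustedIndexBoundAllRows_of_twistUpper` — the crux BY NAME from these two inputs,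
  NO displayed rows.
* §33 `adjustedIndexBoundAllRows_of_gordTwoRankOne_of_twistLower` — the converse, image-free: the crux +
  the rank-zero LOWER half at the Friedberg–Hoffstein-type twists (`L(E^{d_K},1) ≠ 0`) + PUB ⟹ `hLall`
  (the two corners — `p ∤ #𝓞_K^×` automatic, torsion Heegner point when `L(E^{d_K},1) = 0` — as in Part 12).

NET: on cell (G-ord, `e = 2`), rank one, modulo PUBLISHED facts and the rank-ZERO twists' `p`-parts
(UPPER for ⟹, LOWER for ⟸): crux 19358 ⟺ STEP L′ at the Heegner data of its rows. The image of `ρ̄_{E,p}`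
matters only for WHO supplies the twist's upper half. Nothing booked; implications between OPEN statements.

References: [JetchevSkinnerWan2017] §7.4.1–§7.4.2; [GrossZagier1986] I.(6.3), V.§2; [Miller2011LMS] Def. 1.1.
-/

set_option autoImplicit false
set_option linter.dupNamespace false
noncomputable section

open scoped Classical NumberField
open WeierstrassCurve NumberField IsDedekindDomain
  Literature.NumberTheory.EllipticCurves Literature.NumberTheory.EllipticCurves.ModularForms
  Literature.NumberTheory.EllipticCurves.Rank1Residual
  Literature.NumberTheory.EllipticCurves.Rank1Residual.Typed
  Summit.BirchSwinnertonDyer.Rank1Residual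
  Summit.BirchSwinnertonDyer.Rank1Residual.Additive
  Summit.BirchSwinnertonDyer.Rank1Residual.X11b
  Summit.BirchSwinnertonDyer.Rank1Residual.GaloisImage
  Literature.NumberTheory.Automorphic
  Summit.BirchSwinnertonDyer.BirchSwinnertonDyer.Theses.AdditiveBranchIMC

namespace Summit.BirchSwinnertonDyer.BirchSwinnertonDyer.Theorems.AdditiveBranchIMCGordTwoRankOne.HeegnerKolyvagin

/-! ### §31 Pointwise, any image: STEP L′ + the twist's UPPER half ⟹ the lower half -/

/-- **THE POINTWISE LOWER HALF at an additive prime from STEP L′ and the rank-zero UPPER half of the twist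
— ANY image of `ρ̄_{E,p}`.** Data: `W/ℚ` globally minimal of conductor `N`, `ord_{s=1} L(E,s) = 1`, `p` odd,
`Addv W p`; Heegner data (`K` imaginary quadratic, Heegner for `N`, `L(E^{d_K},1) ≠ 0`; `Dt`, `H`, `ι`, `P`);
`Wd = Cd • W^{(d_K)}` globally minimal. PUBLISHED binders `hGZ`, `hKo`, `hGZK`, `hmod`. OPEN inputs: `hL'`
(STEP L′ at the datum) and `htwU : Typed.MissingUpperBoundAt Wd p` (the Euler-system half of the rank-ZERO
twist's `p`-part). CONCLUSION: `Typed.MissingLowerBoundAt W p`. (Part 8's door with `htw` from Part 9's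
`twist_le_half_of_missingUpperBoundAt`; `p ∤ #𝓞_K^×` is automatic, Part 12.)
[cite: JetchevSkinnerWan2017, §7.4.1 (pp. 29–31)] [cite: Miller2011LMS, Def. 1.1] -/
theorem missingLowerBoundAt_rankOne_additive_of_adjustedIndexBound_of_twistUpper
    (W : WeierstrassCurve ℚ) [W.IsElliptic] [W.IsGloballyMinimal] (p : ℕ) [Fact p.Prime]
    [NeZero (W.conductorNorm ℤ)] (K : Type) [Field K] [NumberField K]
    (Dt : ModularParametrizationData W (W.conductorNorm ℤ))
    (H : HeegnerDatum (W.conductorNorm ℤ) (NumberField.discr K)) (ι : K →+* ℂ)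
    (P : (W.baseChange K).toAffine.Point)
    (hGZ : gross_zagier (W.conductorNorm ℤ) W K) (hKo : kolyvagin (W.conductorNorm ℤ) W K)
    (hGZK : rank_eq_analyticRank_of_analyticRank_le_one) (hmod : hasEntireLFunction_rat)
    (hr : W.analyticRank = 1) (hp2 : p ≠ 2) (hadd : Addv W p)
    (hK : IsImaginaryQuadratic K) (hHN : SatisfiesHeegnerHypothesis (W.conductorNorm ℤ) K)
    (hP : WeierstrassCurve.Affine.Point.map ι.toRatAlgHom P = heegnerPointComplex Dt H)
    (hLt : (W.quadraticTwist (NumberField.discr K : ℚ)).entireLFunction 1 ≠ 0)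
    (Wd : WeierstrassCurve ℚ) [Wd.IsElliptic] [Wd.IsGloballyMinimal] (Cd : VariableChange ℚ)
    (hWd : Cd • W.quadraticTwist (NumberField.discr K : ℚ) = Wd)
    (htwU : Typed.MissingUpperBoundAt Wd p)
    (hL' : Finite (W.baseChange K).sha →
      (2 * padicValNat p (AddSubgroup.zmultiples P).index : ℤ) ≤
        padicValNat p (W.baseChange K).shaOrder + padicValNat p W.tamagawaProduct +
          padicValNat p Wd.tamagawaProduct + 2 * padicValRat p (Dt.c : ℚ)) :
    Typed.MissingLowerBoundAt W p := by
  have hp : p.Prime := Fact.out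
  have hpN : p ∣ W.conductorNorm ℤ := (W.dvd_conductorNorm_iff_not_hasGoodReductionAtPrime p).mpr hadd.1
  have hμ : ¬ p ∣ Units.torsionOrder K := not_dvd_unitsTorsionOrder_of_heegner hK hHN hp hp2 hpN
  have hu : padicValRat p (Cd.u : ℚ) = 0 :=
    padicValRat_u_eq_zero_of_twist_minimal' W p K hK hHN hadd.1 Cd hWd
  have hLd1 : Wd.entireLFunction 1 ≠ 0 := twistModel_entireLFunction_one_ne_zero W K hLt Wd Cd hWd
  exact missingLowerBoundAt_of_adjustedIndexBound W p (W.conductorNorm ℤ) K Dt H ι P hGZ hKo hGZK hmod hK hHN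
    hP hp2 hμ hr hLt Wd Cd hWd hu (twist_le_half_of_missingUpperBoundAt hGZK hmod Wd p hLd1 htwU) hL'

/-! ### §32 Class level on ALL rank-one rows of the cell -/

/-- **The crux's conclusion on EVERY rank-one row of cell (G-ord, `e = 2`) — any image, CM or not — from
PUBLISHED facts + STEP L′ on all rows + the rank-zero UPPER half at the twists.** PUBLISHED binders `hGZ`,
`hKo`, `hGZK`, `hmod`, `hnf`, `hmodP`, `hFH`. OPEN inputs: `hLall` — STEP L′ at the Heegner data of every
rank-one row of the cell (the body of item 20498 WITHOUT its image binder; implied by BSD, §33);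
`hUall` — `Typed.MissingUpperBoundAt Wd p` for every globally minimal model `Wd` of the twist by a
Heegner field `K` of the conductor with `L(E^{d_K},1) ≠ 0` (on tower-surjective rows this is Kato 2004
Thm 14.5 (3), PUBLISHED; on small irreducible image Kato + Coates–Sujatha (A), Part 14; on reducible image
an OPEN rank-zero statement). CONCLUSION: `Typed.MissingLowerBoundAt W p` on all rank-one rows. Nothing
booked. [cite: JetchevSkinnerWan2017, §7.4.1 (pp. 29–31)] [cite: Miller2011LMS, Def. 1.1] -/
theorem cellGordTwo_missingLowerBoundAt_rankOne_allRows_of_adjustedIndexBound_of_twistUpper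
    (hGZ : ∀ (N : ℕ) [NeZero N] (W : WeierstrassCurve ℚ) (K : Type) [Field K] [NumberField K],
      gross_zagier N W K)
    (hKo : ∀ (N : ℕ) [NeZero N] (W : WeierstrassCurve ℚ) (K : Type) [Field K] [NumberField K],
      kolyvagin N W K)
    (hGZK : rank_eq_analyticRank_of_analyticRank_le_one) (hmod : hasEntireLFunction_rat)
    (hnf : exists_isNewformOf) (hmodP : nonempty_modularParametrizationData)
    (hFH : friedbergHoffstein_exists_heegnerField_split_twist_ne_zero)
    (hLall : ∀ (W : WeierstrassCurve ℚ) [W.IsElliptic] [W.IsGloballyMinimal] (p : ℕ) [Fact p.Prime]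
      (N : ℕ) [NeZero N] (K : Type) [Field K] [NumberField K]
      (Dt : ModularParametrizationData W N) (H : HeegnerDatum N (NumberField.discr K)) (ι : K →+* ℂ)
      (P : (W.baseChange K).toAffine.Point)
      (Wd : WeierstrassCurve ℚ) [Wd.IsElliptic] [Wd.IsGloballyMinimal] (Cd : VariableChange ℚ),
      W.analyticRank = 1 → N10.CellGordTwo W p →
      W.conductorNorm ℤ = N → IsImaginaryQuadratic K → SatisfiesHeegnerHypothesis N K →
      WeierstrassCurve.Affine.Point.map ι.toRatAlgHom P = heegnerPointComplex Dt H →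
      Cd • W.quadraticTwist (NumberField.discr K : ℚ) = Wd →
      Finite (W.baseChange K).sha →
      (2 * padicValNat p (AddSubgroup.zmultiples P).index : ℤ) ≤
        padicValNat p (W.baseChange K).shaOrder + padicValNat p W.tamagawaProduct +
          padicValNat p Wd.tamagawaProduct + 2 * padicValRat p (Dt.c : ℚ))
    (hUall : ∀ (W : WeierstrassCurve ℚ) [W.IsElliptic] [W.IsGloballyMinimal] (p : ℕ) [Fact p.Prime]
      (K : Type) [Field K] [NumberField K]
      (Wd : WeierstrassCurve ℚ) [Wd.IsElliptic] [Wd.IsGloballyMinimal] (Cd : VariableChange ℚ),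
      W.analyticRank = 1 → N10.CellGordTwo W p →
      IsImaginaryQuadratic K → SatisfiesHeegnerHypothesis (W.conductorNorm ℤ) K →
      (W.quadraticTwist (NumberField.discr K : ℚ)).entireLFunction 1 ≠ 0 →
      Cd • W.quadraticTwist (NumberField.discr K : ℚ) = Wd → Typed.MissingUpperBoundAt Wd p) :
    ∀ (W : WeierstrassCurve ℚ) [W.IsElliptic] [W.IsGloballyMinimal] (p : ℕ) [Fact p.Prime],
      W.analyticRank = 1 → N10.CellGordTwo W p → Typed.MissingLowerBoundAt W p := by
  intro W _ _ p _ hr hc2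
  have hp : p.Prime := Fact.out
  obtain ⟨hp2, hadd, hG, he⟩ := hc2
  haveI : NeZero (W.conductorNorm ℤ) := ⟨(W.conductorNorm_pos_holds).ne'⟩
  -- the sign of the functional equation is `−1` (modularity, `r_an = 1`)
  have hw : W.rootNumber = -1 := by
    rw [WeierstrassCurve.rootNumber_eq_neg_one_pow_analyticRank_of_exists_isNewformOf hnf W, hr]
    norm_num
  -- the auxiliary field (Friedberg–Hoffstein)
  obtain ⟨K, _, _, hK, -, hHN, -, hLt⟩ := hFH W hw p hp 4
  -- the Heegner datum and a minimal twist model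
  obtain ⟨Dt⟩ := hmodP W
  obtain ⟨β, hβ⟩ := exists_dvd_sq_sub_discr_holds (W.conductorNorm ℤ) K hK hHN
  obtain ⟨H, -⟩ := nonempty_heegnerDatum_holds (W.conductorNorm ℤ) K hK hβ
  obtain ⟨ι⟩ : Nonempty (K →+* ℂ) := inferInstance
  obtain ⟨P, hP⟩ := heegnerPointComplex_mem_range_map_holds (W.conductorNorm ℤ) W K hK hHN Dt H ι
  have hD0 : (NumberField.discr K : ℚ) ≠ 0 := by exact_mod_cast NumberField.discr_ne_zero K
  haveI hEt : (W.quadraticTwist (NumberField.discr K : ℚ)).IsElliptic :=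
    W.isElliptic_quadraticTwist hD0
  obtain ⟨Cd, hCd⟩ := hasGlobalMinimalModel_rat_holds (W.quadraticTwist (NumberField.discr K : ℚ))
  haveI : (Cd • W.quadraticTwist (NumberField.discr K : ℚ)).IsGloballyMinimal := hCd
  have hWd : Cd • W.quadraticTwist (NumberField.discr K : ℚ) =
      Cd • W.quadraticTwist (NumberField.discr K : ℚ) := rfl
  exact missingLowerBoundAt_rankOne_additive_of_adjustedIndexBound_of_twistUpper W p K Dt H ι P (hGZ _ W K)
    (hKo _ W K) hGZK hmod hr hp2 hadd hK hHN hP hLt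
    (Cd • W.quadraticTwist (NumberField.discr K : ℚ)) Cd hWd
    (hUall W p K (Cd • W.quadraticTwist (NumberField.discr K : ℚ)) Cd hr ⟨hp2, hadd, hG, he⟩ hK hHN hLt hWd)
    (hLall W p _ K Dt H ι P (Cd • W.quadraticTwist (NumberField.discr K : ℚ)) Cd hr ⟨hp2, hadd, hG, he⟩
      rfl hK hHN hP hWd)

/-- **The crux `GordTwoRankOne` BY NAME from STEP L′ on all rows and the rank-zero twists' UPPER halves —
NO displayed rows, NO image split.** PUBLISHED binders + `hLall` + `hUall` ⟹ `GordTwoRankOne`. (The CM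
rows need no special treatment here; Li–Liu–Tian is simply not used.) Nothing booked; both inputs OPEN
(`hUall` is PUBLISHED only on the tower-surjective rows). [cite: JetchevSkinnerWan2017, §7.4.1 (pp. 29–31)]
[cite: Miller2011LMS, Def. 1.1] -/
theorem gordTwoRankOne_of_adjustedIndexBoundAllRows_of_twistUpper
    (hGZ : ∀ (N : ℕ) [NeZero N] (W : WeierstrassCurve ℚ) (K : Type) [Field K] [NumberField K],
      gross_zagier N W K)
    (hKo : ∀ (N : ℕ) [NeZero N] (W : WeierstrassCurve ℚ) (K : Type) [Field K] [NumberField K],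
      kolyvagin N W K)
    (hGZK : rank_eq_analyticRank_of_analyticRank_le_one) (hmod : hasEntireLFunction_rat)
    (hnf : exists_isNewformOf) (hmodP : nonempty_modularParametrizationData)
    (hFH : friedbergHoffstein_exists_heegnerField_split_twist_ne_zero)
    (hLall : ∀ (W : WeierstrassCurve ℚ) [W.IsElliptic] [W.IsGloballyMinimal] (p : ℕ) [Fact p.Prime]
      (N : ℕ) [NeZero N] (K : Type) [Field K] [NumberField K]
      (Dt : ModularParametrizationData W N) (H : HeegnerDatum N (NumberField.discr K)) (ι : K →+* ℂ)
      (P : (W.baseChange K).toAffine.Point)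
      (Wd : WeierstrassCurve ℚ) [Wd.IsElliptic] [Wd.IsGloballyMinimal] (Cd : VariableChange ℚ),
      W.analyticRank = 1 → N10.CellGordTwo W p →
      W.conductorNorm ℤ = N → IsImaginaryQuadratic K → SatisfiesHeegnerHypothesis N K →
      WeierstrassCurve.Affine.Point.map ι.toRatAlgHom P = heegnerPointComplex Dt H →
      Cd • W.quadraticTwist (NumberField.discr K : ℚ) = Wd →
      Finite (W.baseChange K).sha →
      (2 * padicValNat p (AddSubgroup.zmultiples P).index : ℤ) ≤
        padicValNat p (W.baseChange K).shaOrder + padicValNat p W.tamagawaProduct +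
          padicValNat p Wd.tamagawaProduct + 2 * padicValRat p (Dt.c : ℚ))
    (hUall : ∀ (W : WeierstrassCurve ℚ) [W.IsElliptic] [W.IsGloballyMinimal] (p : ℕ) [Fact p.Prime]
      (K : Type) [Field K] [NumberField K]
      (Wd : WeierstrassCurve ℚ) [Wd.IsElliptic] [Wd.IsGloballyMinimal] (Cd : VariableChange ℚ),
      W.analyticRank = 1 → N10.CellGordTwo W p →
      IsImaginaryQuadratic K → SatisfiesHeegnerHypothesis (W.conductorNorm ℤ) K →
      (W.quadraticTwist (NumberField.discr K : ℚ)).entireLFunction 1 ≠ 0 →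
      Cd • W.quadraticTwist (NumberField.discr K : ℚ) = Wd → Typed.MissingUpperBoundAt Wd p) :
    GordTwoRankOne :=
  fun W _ _ p _ hr hc2 ↦
    cellGordTwo_missingLowerBoundAt_rankOne_allRows_of_adjustedIndexBound_of_twistUpper hGZ hKo hGZK hmod hnf
      hmodP hFH hLall hUall W p hr hc2

/-! ### §33 The converse, image-free: the crux returns STEP L′ at every Heegner datum of every row -/

/-- **No free lunch, ALL rows.** `GordTwoRankOne` (hypothesis) + the rank-zero LOWER half
`Typed.MissingLowerBoundAt Wd p` at the twists by Heegner fields with `L(E^{d_K},1) ≠ 0` + PUBLISHED `hGZ`,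
`hKo`, `hGZK`, `hmod` ⟹ STEP L′ at EVERY Heegner datum of EVERY rank-one row of the cell (`hLall`'s body; no
image condition): the binder `p ∤ #𝓞_K^×` is automatic (`not_dvd_unitsTorsionOrder_of_heegner`), and at a
field with `L(E^{d_K},1) = 0` the Heegner point is torsion in the infinite group `E(K)`, so the index is `0`
(Part 12). With §32: crux 19358 ⟺ STEP L′-on-all-rows modulo PUBLISHED facts and the rank-zero twists'
`p`-parts. [cite: JetchevSkinnerWan2017, §7.4.1 (pp. 29–31)] [cite: GrossZagier1986, Thm. I.(6.3) and V.§2]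
[cite: Miller2011LMS, Def. 1.1] -/
theorem adjustedIndexBoundAllRows_of_gordTwoRankOne_of_twistLower
    (hcrux : GordTwoRankOne)
    (hGZ : ∀ (N : ℕ) [NeZero N] (W : WeierstrassCurve ℚ) (K : Type) [Field K] [NumberField K],
      gross_zagier N W K)
    (hKo : ∀ (N : ℕ) [NeZero N] (W : WeierstrassCurve ℚ) (K : Type) [Field K] [NumberField K],
      kolyvagin N W K)
    (hGZK : rank_eq_analyticRank_of_analyticRank_le_one) (hmod : hasEntireLFunction_rat)
    (hTwL : ∀ (W : WeierstrassCurve ℚ) [W.IsElliptic] [W.IsGloballyMinimal] (p : ℕ) [Fact p.Prime]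
      (K : Type) [Field K] [NumberField K]
      (Wd : WeierstrassCurve ℚ) [Wd.IsElliptic] [Wd.IsGloballyMinimal] (Cd : VariableChange ℚ),
      W.analyticRank = 1 → N10.CellGordTwo W p →
      IsImaginaryQuadratic K → SatisfiesHeegnerHypothesis (W.conductorNorm ℤ) K →
      (W.quadraticTwist (NumberField.discr K : ℚ)).entireLFunction 1 ≠ 0 →
      Cd • W.quadraticTwist (NumberField.discr K : ℚ) = Wd → Typed.MissingLowerBoundAt Wd p) :
    ∀ (W : WeierstrassCurve ℚ) [W.IsElliptic] [W.IsGloballyMinimal] (p : ℕ) [Fact p.Prime]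
      (N : ℕ) [NeZero N] (K : Type) [Field K] [NumberField K]
      (Dt : ModularParametrizationData W N) (H : HeegnerDatum N (NumberField.discr K)) (ι : K →+* ℂ)
      (P : (W.baseChange K).toAffine.Point)
      (Wd : WeierstrassCurve ℚ) [Wd.IsElliptic] [Wd.IsGloballyMinimal] (Cd : VariableChange ℚ),
      W.analyticRank = 1 → N10.CellGordTwo W p →
      W.conductorNorm ℤ = N → IsImaginaryQuadratic K → SatisfiesHeegnerHypothesis N K →
      WeierstrassCurve.Affine.Point.map ι.toRatAlgHom P = heegnerPointComplex Dt H →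
      Cd • W.quadraticTwist (NumberField.discr K : ℚ) = Wd →
      Finite (W.baseChange K).sha →
      (2 * padicValNat p (AddSubgroup.zmultiples P).index : ℤ) ≤
        padicValNat p (W.baseChange K).shaOrder + padicValNat p W.tamagawaProduct +
          padicValNat p Wd.tamagawaProduct + 2 * padicValRat p (Dt.c : ℚ) := by
  intro W _ _ p _ N _ K _ _ Dt H ι P Wd _ _ Cd hr hcell hN hK hHN hP hWd _hfin
  have hp : p.Prime := Fact.out
  have hp2 : p ≠ 2 := hcell.1
  have hadd : Addv W p := hcell.2.1
  have hpN : p ∣ N := by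
    rw [← hN]; exact (W.dvd_conductorNorm_iff_not_hasGoodReductionAtPrime p).mpr hadd.1
  have hμ : ¬ p ∣ Units.torsionOrder K := not_dvd_unitsTorsionOrder_of_heegner hK hHN hp hp2 hpN
  by_cases hLt : (W.quadraticTwist (NumberField.discr K : ℚ)).entireLFunction 1 = 0
  · -- degenerate corner: the Heegner point is torsion, the index is `0`
    have htor : IsOfFinAddOrder P :=
      isOfFinAddOrder_heegnerPoint_of_twist_value_eq_zero W N K Dt H ι P (hGZ N W K) hmod hK hHN hP hr hLt
    haveI : Infinite (W.baseChange K).toAffine.Point :=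
      infinite_point_baseChange_of_analyticRank_eq_one hGZK W K hK.1 hr
    rw [index_zmultiples_eq_zero_of_isOfFinAddOrder htor]
    have e3 : (0 : ℤ) ≤ padicValRat p (Dt.c : ℚ) := by rw [padicValRat.of_int]; positivity
    have e4 : (0 : ℤ) ≤ (padicValNat p (W.baseChange K).shaOrder : ℤ) + padicValNat p W.tamagawaProduct +
        padicValNat p Wd.tamagawaProduct := by positivity
    simp only [padicValNat_zero_right, Nat.cast_zero, mul_zero]
    linarith
  · have hSH : SatisfiesHeegnerHypothesis (W.conductorNorm ℤ) K := by rw [hN]; exact hHN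
    exact adjustedIndexBound_of_gordTwoRankOne_of_twistLower hcrux W p N K Dt H ι P (hGZ N W K)
      (hKo N W K) hGZK hmod hr hcell hN hK hHN hP hμ hLt Wd Cd hWd
      (hTwL W p K Wd Cd hr hcell hK hSH hLt hWd)

end Summit.BirchSwinnertonDyer.BirchSwinnertonDyer.Theorems.AdditiveBranchIMCGordTwoRankOne.HeegnerKolyvagin

end
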